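import Mathlib

/-!
# Crux `PercNearOneGluing.NoHeavyLowerTail` (stmt-CriticalPhenomena-4575), line
`bhk-superadditivity-thinning` — stub `coinExpansion_disjoint` (independent-coin subset expansion)

Helper file for the crux skeleton (lead prover-line-stmt-CriticalPhenomena-4575-c3-0): proves
exactly the registered stub signature `coinExpansion_disjoint`; lands with
`--supports stmt-CriticalPhenomena-4575`.

## Content

Independent coins on a finite index set `S ⊆ ℕ` with `P(a open) = q a`: the weight of the open set
`Z ⊆ S` is `(∏_{a ∈ Z} q a) (∏_{a ∈ S \ Z} (1 - q a))`, and the probability that the open set misses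
`T` is `∏_{a ∈ S ∩ T} (1 - q a)`:

`∑_{Z ⊆ S} 1{Z ∩ T = ∅} (∏_{a ∈ Z} q a) (∏_{a ∈ S \ Z} (1 - q a)) = ∏_{a ∈ S, a ∈ T} (1 - q a)`.

This is a polynomial identity in the `q a` (no sign hypotheses).  It is the bookkeeping identity by
which the block Star Lemma turns products `∏_L (1 - ∏_cl)` into sums over coin patterns `Z`.

## Proof

Apply `Finset.prod_add` (`∏_{a ∈ S} (f a + g a) = ∑_{Z ⊆ S} (∏_{a ∈ Z} f a) (∏_{a ∈ S \ Z} g a)`)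
with `f a = 1{a ∉ T} q a` and `g a = 1 - q a`.  Then `f a + g a` is `1 - q a` for `a ∈ T` and `1`
otherwise, so the left side is `∏_{a ∈ S, a ∈ T} (1 - q a)` (`Finset.prod_filter`), while
`∏_{a ∈ Z} f a = 1{Z ∩ T = ∅} ∏_{a ∈ Z} q a` (`Finset.prod_ite_zero`, `Finset.disjoint_left`).
-/

namespace Summit.CriticalPhenomena.PercolationContinuityZ3.Theorems

/-- **Independent-coin subset expansion** (stub `coinExpansion_disjoint` of
stmt-CriticalPhenomena-4575).  For independent coins on `S` with weights `q a`, summing the pattern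
weights `(∏_{a ∈ Z} q a) (∏_{a ∈ S \ Z} (1 - q a))` over the open sets `Z ⊆ S` disjoint from `T`
gives `∏_{a ∈ S ∩ T} (1 - q a)` (the probability that no coin of `T` is open).  A polynomial
identity, valid for arbitrary real `q`; proved from `Finset.prod_add` with `f = 1{· ∉ T} q`,
`g = 1 - q`. -/
theorem coinExpansion_disjoint : ∀ (S T : Finset ℕ) (q : ℕ → ℝ), ∑ Z ∈ S.powerset, (if Disjoint Z T then (∏ a ∈ Z, q a) * (∏ a ∈ S \ Z, (1 - q a)) else 0) = ∏ a ∈ S.filter (fun a => a ∈ T), (1 - q a) := by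
  intro S T q
  have key : ∏ a ∈ S, ((if a ∉ T then q a else 0) + (1 - q a))
      = ∏ a ∈ S.filter (fun a => a ∈ T), (1 - q a) := by
    rw [Finset.prod_filter]
    refine Finset.prod_congr rfl (fun a _ => ?_)
    by_cases h : a ∈ T
    · rw [if_neg (fun h' => h' h), if_pos h, zero_add]
    · rw [if_pos h, if_neg h, add_sub_cancel]
  rw [← key, Finset.prod_add]
  refine Finset.sum_congr rfl (fun Z _ => ?_)
  rw [Finset.prod_ite_zero]
  by_cases hZT : Disjoint Z T
  · rw [if_pos hZT, if_pos (fun a ha => Finset.disjoint_left.1 hZT ha)]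
  · rw [if_neg hZT, if_neg (fun h => hZT (Finset.disjoint_left.2 (fun a ha => h a ha))), zero_mul]

end Summit.CriticalPhenomena.PercolationContinuityZ3.Theorems
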